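import Literature.Computability.MetaComplexity.RefuterBinarySearch
import HarnessLib

/-!
# Local consistency of claimed witness counts, and the three incriminating queries

Topic `Computability/MetaComplexity` (refuters for `PP`, Chen–Jin–Santhanam–Williams [ChenEtAl2022],
§5.3, proof of Thm. 6), continuing `RefuterBinarySearch.lean`.

The printed proof lets the refuted algorithm `A` play the `PP` oracle of the counting binary search
for `#SAT(φ)` and looks for a formula on which the claimed counts violate the self-reduction
`#SAT(φ) = #SAT(φ₀) + #SAT(φ₁)`; from such a violation it extracts THREE queries among which `A`
answered one incorrectly ([ChenEtAl2022, §5.3]: "we obtain a list of three strings that contains at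
least one counterexample"). We run the same argument on the witness counts of an arbitrary `P`
relation `R` (downstream: the majority-vote witnesses of the `PP`-complete language itself, so that no
`#SAT` machinery is needed): for an input `x`, witness length `m` and a prefix `u`,

* `pcnt R x m u = #{v ∈ {0,1}^{m-|u|} | ⟨x, u·v⟩ ∈ R}` — the prefix-refined witness count; it splits as
  `pcnt u = pcnt (u0) + pcnt (u1)` (`pcnt_split`), is an indicator at the leaves (`pcnt_leaf`), is
  at most `2^{m-|u|}` (`pcnt_le`), is the tree's witness count at the root (`pcnt_nil`) and is the
  length-`m` count of the strings with prefix `u` (`cnt_prefix_eq_pcnt`, the event the threshold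
  oracle of `ThresholdPP.lean` counts downstream);
* `eq_pcnt_of_consistent` — a claimed-value function that is right at the leaves and additive at
  the inner nodes is right everywhere ("an induction on `m`", [ChenEtAl2022, §5.2–5.3]);
* the node analysis `exists_mem_nodeList_disagree` and the leaf analysis
  `exists_mem_leafList_disagree`: if the values `c, a, b` claimed by the binary searches at
  `u, u0, u1` (against the oracle `A`, through a query embedding `τ` whose TRUE answers are the
  threshold questions) are out of range or violate `c = a + b` — resp. if the claimed leaf value is
  not the indicator — then among three explicitly computed queries (`nodeList`, always the tags
  `u, u0, u1` with one numeral each: `nuU, nuZero, nuOne`) one is answered by `A` differently from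
  the truth `L`. The numerals are total arithmetic expressions in `c, a, b` (no case split on which
  slot is the culprit), which is what the refuter machine downstream computes. Tests are
  Boolean-valued (`badNode`), as the machine computes bits.

## References

* L. Chen, C. Jin, R. Santhanam, R. Williams, *Constructive separations and their consequences*,
  FOCS 2021 = TheoretiCS 3 (2024), §5.3, proof of Thm. 6 (the two cases `Σ(cⱼ-aⱼ-bⱼ)2ʲ ≤ -1` and
  `> 0`) [ChenEtAl2022].
* S. Arora, B. Barak, *Computational Complexity: A Modern Approach*, CUP 2009, §17.2.1 [AroraBarak2009].
-/

namespace Literature.Computability.MetaComplexity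

open _root_.Computability Literature.Computability.Complexity Literature.Computability.Complexity.CoinEnum
  Literature.Computability.Complexity.PPSharpP

namespace PPRefuter

/-! ### Prefix-refined witness counts -/

/-- **The prefix-refined witness count** `pcnt R x m u = #{v ∈ {0,1}^{m-|u|} | ⟨x, u ++ v⟩ ∈ R}`
(meaningful for `|u| ≤ m`). With `u = []` this is the tree's `countWitnesses R m x`. The analogue of
`#SAT(φ)` restricted along a partial assignment in [ChenEtAl2022, §5.3]. [cite: ChenEtAl2022, §5.3 (proof of Thm. 6)] -/
noncomputable def pcnt (R : Language Bool) (x : List Bool) (m : ℕ) (u : List Bool) : ℕ :=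
  cnt (m - u.length) {v | boolPair x (u ++ v) ∈ R}

variable {R : Language Bool} {x : List Bool} {m : ℕ}

/-- **Self-reduction of the counts**: `pcnt u = pcnt (u0) + pcnt (u1)` for `|u| < m`.
[cite: ChenEtAl2022, §5.3 (`#SAT(φ) = #SAT(φ₀) + #SAT(φ₁)`)] -/
theorem pcnt_split {u : List Bool} (hu : u.length < m) :
    pcnt R x m u = pcnt R x m (u ++ [false]) + pcnt R x m (u ++ [true]) := by
  unfold pcnt
  rw [List.length_append, List.length_singleton, show m - u.length = (m - (u.length + 1)) + 1 by omega, cnt_succ]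
  simp [List.append_assoc]

/-- **Leaves**: for `|u| = m` the count is the indicator of `⟨x, u⟩ ∈ R`. [folklore] -/
theorem pcnt_leaf {u : List Bool} (hu : u.length = m) :
    pcnt R x m u = (R.boolIndicator (boolPair x u)).toNat := by
  classical
  unfold pcnt
  rw [hu, Nat.sub_self, cnt_zero]
  by_cases h : boolPair x u ∈ R
  · rw [if_pos (by simpa using h), (Set.mem_iff_boolIndicator _ _).1 h]; rfl
  · rw [if_neg (by simpa using h), (Set.notMem_iff_boolIndicator _ _).1 h]; rfl

/-- The leaf count is at most `1`. [folklore] -/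
theorem pcnt_leaf_le_one {u : List Bool} (hu : u.length = m) : pcnt R x m u ≤ 1 := by
  rw [pcnt_leaf hu]; exact Bool.toNat_le _

/-- The count is at most `2^{m-|u|}`. [folklore] -/
theorem pcnt_le (u : List Bool) : pcnt R x m u ≤ 2 ^ (m - u.length) := cnt_le _ _

/-- **The root**: `pcnt R x m [] = countWitnesses R m x`. [folklore] -/
theorem pcnt_nil : pcnt R x m [] = countWitnesses R m x := by
  rw [countWitnesses_eq_cnt]; simp [pcnt]

/-- Counting the strings with a given prefix: for every predicate `P`,
`#{w ∈ {0,1}^{|u|+k} | w ↾ |u| = u ∧ P w} = #{v ∈ {0,1}^k | P (u ++ v)}`. [folklore] -/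
theorem cnt_prefix (u : List Bool) (k : ℕ) (P : List Bool → Prop) :
    cnt (u.length + k) {w | w.take u.length = u ∧ P w} = cnt k {v | P (u ++ v)} := by
  induction u generalizing P with
  | nil => simp
  | cons b u ih =>
    rw [List.length_cons, show u.length + 1 + k = (u.length + k) + 1 by omega, cnt_succ]
    have hsame : cnt (u.length + k) {y | b :: y ∈ {w : List Bool | w.take (u.length + 1) = b :: u ∧ P w}} =
        cnt k {v | P (b :: u ++ v)} := by
      rw [show ({v | P (b :: u ++ v)} : Set (List Bool)) = {v | P (b :: (u ++ v))} from rfl, ← ih (fun w => P (b :: w))]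
      exact cnt_congr fun y _ => by simp
    have hother : cnt (u.length + k) {y | (!b) :: y ∈ {w : List Bool | w.take (u.length + 1) = b :: u ∧ P w}} = 0 := by
      have := (cnt_pos_iff (u.length + k) {y | (!b) :: y ∈ {w : List Bool | w.take (u.length + 1) = b :: u ∧ P w}}).not
      simp only [not_lt, Nat.le_zero, not_exists, not_and] at this
      exact this.2 fun y _ hy => by cases b <;> simp at hy
    cases b
    · change cnt _ {y | false :: y ∈ _} + cnt _ {y | (!false) :: y ∈ _} = _
      rw [hsame, hother, Nat.add_zero]
    · change cnt _ {y | (!true) :: y ∈ _} + cnt _ {y | true :: y ∈ _} = _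
      rw [hsame, hother, Nat.zero_add]

/-- **The prefix event has the prefix count**: for `|u| ≤ m`,
`#{w ∈ {0,1}^m | w ↾ |u| = u ∧ ⟨x, w⟩ ∈ R} = pcnt R x m u`. [folklore] -/
theorem cnt_prefix_eq_pcnt {u : List Bool} (hu : u.length ≤ m) :
    cnt m {w | w.take u.length = u ∧ boolPair x w ∈ R} = pcnt R x m u := by
  obtain ⟨k, rfl⟩ := Nat.exists_eq_add_of_le hu
  rw [cnt_prefix, pcnt, Nat.add_sub_cancel_left]

/-! ### Consistent claims are correct -/

/-- **A locally consistent claimed-value function is the true count.** If `g` agrees with the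
indicator at every leaf `|u| = m` and satisfies `g u = g (u0) + g (u1)` at every `|u| < m`, then
`g u = pcnt u` for all `|u| ≤ m`. ("since otherwise … an induction on `m` would imply
`A(pₙ(x)) = M(x)` for all `x`", [ChenEtAl2022, §5.2], transposed to counts as in §5.3.)
[cite: ChenEtAl2022, §5.3 (proof of Thm. 6)] -/
theorem eq_pcnt_of_consistent {g : List Bool → ℕ}
    (hleaf : ∀ u : List Bool, u.length = m → g u = pcnt R x m u)
    (hnode : ∀ u : List Bool, u.length < m → g u = g (u ++ [false]) + g (u ++ [true])) :
    ∀ u : List Bool, u.length ≤ m → g u = pcnt R x m u := by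
  suffices h : ∀ d (u : List Bool), u.length + d = m → g u = pcnt R x m u from
    fun u hu => h (m - u.length) u (by omega)
  intro d
  induction d with
  | zero => intro u hu; exact hleaf u (by omega)
  | succ d ih =>
    intro u hu
    rw [hnode u (by omega), pcnt_split (by omega), ih _ (by simp; omega), ih _ (by simp; omega)]

/-! ### The three incriminating queries at an inner node -/

section Node

variable (D : ℕ) (c a b K : ℕ)

/-- Numeral index for the tag `u`: `c - 1` when the search at `u` must have said a YES that is
used (claimed value too large, or `c > a + b`), else `c`. [cite: ChenEtAl2022, §5.3 (proof of Thm. 6)] -/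
def nuU : ℕ := if K < c ∨ a + b < c then c - 1 else c

/-- Numeral index for the tag `u0`. [cite: ChenEtAl2022, §5.3 (proof of Thm. 6)] -/
def nuZero : ℕ := if K / 2 < a ∨ (c < a + b ∧ 0 < a) then a - 1 else a

/-- Numeral index for the tag `u1`. [cite: ChenEtAl2022, §5.3 (proof of Thm. 6)] -/
def nuOne : ℕ := if K / 2 < b ∨ (c < a + b ∧ 0 < b) then b - 1 else b

/-- **The three queries output at an inner node** `u` (tags `u, u0, u1`, width-`D` numerals).
[cite: ChenEtAl2022, §5.3 (proof of Thm. 6: "a list of three strings")] -/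
def nodeList (u : List Bool) : List (List Bool × List Bool) :=
  [(u, natBits D (nuU c a b K)), (u ++ [false], natBits D (nuZero c a b K)), (u ++ [true], natBits D (nuOne c a b K))]

/-- **Local inconsistency at an inner node** (Boolean test): a claimed value out of range, or
`c ≠ a + b`. [cite: ChenEtAl2022, §5.3 (proof of Thm. 6: `D^A(φ) ≠ D^A(φ₀) + D^A(φ₁)`)] -/
def badNode : Bool := decide (K < c) || decide (K / 2 < a) || decide (K / 2 < b) || decide (c ≠ a + b)

/-- Reading the inconsistency test. [folklore] -/
theorem badNode_eq_true_iff : badNode c a b K = true ↔ K < c ∨ K / 2 < a ∨ K / 2 < b ∨ c ≠ a + b := by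
  simp only [badNode, Bool.or_eq_true, decide_eq_true_eq, or_assoc]

end Node

variable {L A : Language Bool} {τ : List Bool → List Bool → List Bool} {D : ℕ}

/-- The answer predicate of the oracle `A` behind the embedding `τ` at the tag `t`. [folklore] -/
noncomputable def ansOf (A : Language Bool) (τ : List Bool → List Bool → List Bool) (t : List Bool) :
    List Bool → Bool :=
  fun s => A.boolIndicator (τ t s)

/-- Reading a YES certificate through a truthful embedding: if `A` says YES on the numeral of
`g - 1` and agrees with the truth there, then `g ≤` the true count. [folklore] -/
theorem le_of_yes {t : List Bool} {g S : ℕ} (hg : 0 < g) (hgD : g ≤ 2 ^ D)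
    (htruth : τ t (natBits D (g - 1)) ∈ L ↔ bitsToNat (natBits D (g - 1)) < S)
    (hyes : ansOf A τ t (natBits D (g - 1)) = true)
    (hagree : τ t (natBits D (g - 1)) ∈ A ↔ τ t (natBits D (g - 1)) ∈ L) : g ≤ S := by
  have hA : τ t (natBits D (g - 1)) ∈ A := (Set.mem_iff_boolIndicator _ _).2 hyes
  have := (htruth.1 (hagree.1 hA))
  rw [bitsToNat_natBits (by omega)] at this
  omega

/-- Reading a NO certificate through a truthful embedding: if `A` says NO on the numeral of `g`
and agrees with the truth there, then the true count is `≤ g`. [folklore] -/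
theorem ge_of_no {t : List Bool} {g S : ℕ} (hgD : g < 2 ^ D)
    (htruth : τ t (natBits D g) ∈ L ↔ bitsToNat (natBits D g) < S)
    (hno : ansOf A τ t (natBits D g) = false)
    (hagree : τ t (natBits D g) ∈ A ↔ τ t (natBits D g) ∈ L) : S ≤ g := by
  have hA : τ t (natBits D g) ∉ A := (Set.notMem_iff_boolIndicator _ _).2 hno
  have := mt htruth.2 (fun h => hA (hagree.2 h))
  rw [bitsToNat_natBits hgD] at this
  omega

/-- **The node analysis** ([ChenEtAl2022, §5.3, the two displayed cases]). Let `|u| < m`,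
`K = 2^{m-|u|}` (so the true counts at `u, u0, u1` are `≤ K, K/2, K/2`) and `K < 2^D - 1`. Let
`c, a, b` be the values claimed by the width-`D` searches at the tags `u, u0, u1` against `A`
through an embedding `τ` whose true answers are the threshold questions
(`τ t s ∈ L ↔ val s < pcnt t`). If `badNode c a b K` holds then one of the three queries of
`nodeList` is answered by `A` differently from `L`. [cite: ChenEtAl2022, §5.3 (proof of Thm. 6)] -/
theorem exists_mem_nodeList_disagree {u : List Bool} (hu : u.length < m) (hKD : 2 ^ (m - u.length) < 2 ^ D - 1)
    (htruth : ∀ (t s : List Bool), t.length ≤ m → s.length = D → (τ t s ∈ L ↔ bitsToNat s < pcnt R x m t))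
    (hbad : badNode (bsVal D (ansOf A τ u)) (bsVal D (ansOf A τ (u ++ [false])))
      (bsVal D (ansOf A τ (u ++ [true]))) (2 ^ (m - u.length)) = true) :
    ∃ e ∈ nodeList D (bsVal D (ansOf A τ u)) (bsVal D (ansOf A τ (u ++ [false])))
        (bsVal D (ansOf A τ (u ++ [true]))) (2 ^ (m - u.length)) u,
      ¬ (τ e.1 e.2 ∈ A ↔ τ e.1 e.2 ∈ L) := by
  set c := bsVal D (ansOf A τ u) with hc
  set a := bsVal D (ansOf A τ (u ++ [false])) with ha
  set b := bsVal D (ansOf A τ (u ++ [true])) with hb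
  set K := 2 ^ (m - u.length) with hK
  have hK2 : K / 2 = 2 ^ (m - (u.length + 1)) := by
    rw [hK, show m - u.length = (m - (u.length + 1)) + 1 by omega, pow_succ]; simp
  have hcD : c < 2 ^ D := bsVal_lt_two_pow
  have haD : a < 2 ^ D := bsVal_lt_two_pow
  have hbD : b < 2 ^ D := bsVal_lt_two_pow
  have htr : ∀ (t : List Bool) (g : ℕ), t.length ≤ m → (τ t (natBits D g) ∈ L ↔ bitsToNat (natBits D g) < pcnt R x m t) :=
    fun t g ht => htruth t _ ht (length_natBits _ _)
  have hu0 : (u ++ [false]).length ≤ m := by simp; omega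
  have hu1 : (u ++ [true]).length ≤ m := by simp; omega
  -- true counts and their ranges
  have hsplit := pcnt_split (R := R) (x := x) hu
  have hPu : pcnt R x m u ≤ K := pcnt_le u
  have hP0 : pcnt R x m (u ++ [false]) ≤ K / 2 := by rw [hK2]; simpa using pcnt_le (R := R) (x := x) (m := m) (u ++ [false])
  have hP1 : pcnt R x m (u ++ [true]) ≤ K / 2 := by rw [hK2]; simpa using pcnt_le (R := R) (x := x) (m := m) (u ++ [true])
  by_contra hall
  push Not at hall
  have e1 := hall (u, natBits D (nuU c a b K)) (by simp [nodeList])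
  have e2 := hall (u ++ [false], natBits D (nuZero c a b K)) (by simp [nodeList])
  have e3 := hall (u ++ [true], natBits D (nuOne c a b K)) (by simp [nodeList])
  simp only at e1 e2 e3
  rw [badNode_eq_true_iff] at hbad
  rcases hbad with h1 | h2 | h3 | h4
  · -- `c > K`: the YES on `c - 1` at `u` is false
    have hnu : nuU c a b K = c - 1 := by simp [nuU, h1]
    rw [hnu] at e1
    have := le_of_yes (A := A) (by omega) hcD.le (htr u (c - 1) hu.le) (ans_natBits_pred_of_pos (by omega)) e1
    omega
  · have hnu : nuZero c a b K = a - 1 := by simp [nuZero, h2]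
    rw [hnu] at e2
    have := le_of_yes (A := A) (by omega) haD.le (htr _ (a - 1) hu0) (ans_natBits_pred_of_pos (by omega)) e2
    omega
  · have hnu : nuOne c a b K = b - 1 := by simp [nuOne, h3]
    rw [hnu] at e3
    have := le_of_yes (A := A) (by omega) hbD.le (htr _ (b - 1) hu1) (ans_natBits_pred_of_pos (by omega)) e3
    omega
  · by_cases h1 : K < c
    · have hnu : nuU c a b K = c - 1 := by simp [nuU, h1]
      rw [hnu] at e1
      have := le_of_yes (A := A) (by omega) hcD.le (htr u (c - 1) hu.le) (ans_natBits_pred_of_pos (by omega)) e1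
      omega
    by_cases h2 : K / 2 < a
    · have hnu : nuZero c a b K = a - 1 := by simp [nuZero, h2]
      rw [hnu] at e2
      have := le_of_yes (A := A) (by omega) haD.le (htr _ (a - 1) hu0) (ans_natBits_pred_of_pos (by omega)) e2
      omega
    by_cases h3 : K / 2 < b
    · have hnu : nuOne c a b K = b - 1 := by simp [nuOne, h3]
      rw [hnu] at e3
      have := le_of_yes (A := A) (by omega) hbD.le (htr _ (b - 1) hu1) (ans_natBits_pred_of_pos (by omega)) e3
      omega
    push Not at h1 h2 h3
    rcases Nat.lt_or_gt_of_ne h4 with hlt | hgt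
    · -- `c < a + b`: NO at `u` on `c`, YES at `u0` on `a - 1` (if `a > 0`), YES at `u1` on `b - 1`
      have hnu : nuU c a b K = c := by simp [nuU]; omega
      rw [hnu] at e1
      have hcle : pcnt R x m u ≤ c := ge_of_no (A := A) hcD (htr u c hu.le) (ans_natBits_of_lt (by omega)) e1
      have hale : a ≤ pcnt R x m (u ++ [false]) := by
        rcases Nat.eq_zero_or_pos a with ha0 | ha0
        · omega
        · have hnu : nuZero c a b K = a - 1 := by simp [nuZero]; omega
          rw [hnu] at e2
          exact le_of_yes (A := A) ha0 haD.le (htr _ (a - 1) hu0) (ans_natBits_pred_of_pos ha0) e2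
      have hble : b ≤ pcnt R x m (u ++ [true]) := by
        rcases Nat.eq_zero_or_pos b with hb0 | hb0
        · omega
        · have hnu : nuOne c a b K = b - 1 := by simp [nuOne]; omega
          rw [hnu] at e3
          exact le_of_yes (A := A) hb0 hbD.le (htr _ (b - 1) hu1) (ans_natBits_pred_of_pos hb0) e3
      omega
    · -- `c > a + b`: YES at `u` on `c - 1`, NO at `u0` on `a`, NO at `u1` on `b`
      have hnu : nuU c a b K = c - 1 := by simp [nuU]; omega
      rw [hnu] at e1
      have hcle : c ≤ pcnt R x m u := le_of_yes (A := A) (by omega) hcD.le (htr u (c - 1) hu.le) (ans_natBits_pred_of_pos (by omega)) e1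
      have hnu0 : nuZero c a b K = a := by simp [nuZero]; omega
      rw [hnu0] at e2
      have hale : pcnt R x m (u ++ [false]) ≤ a := ge_of_no (A := A) haD (htr _ a hu0) (ans_natBits_of_lt (by omega)) e2
      have hnu1 : nuOne c a b K = b := by simp [nuOne]; omega
      rw [hnu1] at e3
      have hble : pcnt R x m (u ++ [true]) ≤ b := ge_of_no (A := A) hbD (htr _ b hu1) (ans_natBits_of_lt (by omega)) e3
      omega

/-! ### The incriminating query at a leaf -/

/-- Numeral index at a leaf: `c - 1` if the claimed value exceeds the indicator, else `c`.
[cite: ChenEtAl2022, §5.3 (proof of Thm. 6)] -/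
def nuLeaf (c i : ℕ) : ℕ := if i < c then c - 1 else c

/-- **The leaf analysis**: at `|u| = m` the true count is the indicator `i` of `⟨x, u⟩ ∈ R`; if the
claimed value `c ≠ i` (and `1 ≤ 2^D - 1`), the query with numeral `nuLeaf c i` at the tag `u` is
answered by `A` differently from `L`. [cite: ChenEtAl2022, §5.3 (proof of Thm. 6)] -/
theorem leaf_disagree {u : List Bool} (hu : u.length = m) (hD : 1 < 2 ^ D - 1)
    (htruth : ∀ (t s : List Bool), t.length ≤ m → s.length = D → (τ t s ∈ L ↔ bitsToNat s < pcnt R x m t))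
    (hbad : bsVal D (ansOf A τ u) ≠ pcnt R x m u) :
    ¬ (τ u (natBits D (nuLeaf (bsVal D (ansOf A τ u)) (pcnt R x m u))) ∈ A ↔
        τ u (natBits D (nuLeaf (bsVal D (ansOf A τ u)) (pcnt R x m u))) ∈ L) := by
  set c := bsVal D (ansOf A τ u) with hc
  set i := pcnt R x m u with hi
  have hi1 : i ≤ 1 := pcnt_leaf_le_one hu
  have hcD : c < 2 ^ D := bsVal_lt_two_pow
  have htr : ∀ g : ℕ, τ u (natBits D g) ∈ L ↔ bitsToNat (natBits D g) < pcnt R x m u :=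
    fun g => htruth u _ hu.le (length_natBits _ _)
  intro hagree
  by_cases hic : i < c
  · have hnu : nuLeaf c i = c - 1 := by simp [nuLeaf, hic]
    rw [hnu] at hagree
    have := le_of_yes (A := A) (by omega) hcD.le (htr (c - 1)) (ans_natBits_pred_of_pos (by omega)) hagree
    omega
  · have hnu : nuLeaf c i = c := by simp [nuLeaf, hic]
    rw [hnu] at hagree
    have := ge_of_no (A := A) hcD (htr c) (ans_natBits_of_lt (by omega)) hagree
    omega

/-! ### Consistency gives the right count at the root -/

/-- **If no node of the tree below `x` is locally inconsistent, the claimed root value is the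
witness count.** Hypotheses: at every inner node `badNode = false`, at every leaf the claimed value
is the indicator. Conclusion: the value claimed at `u = []` is `countWitnesses R m x`.
[cite: ChenEtAl2022, §5.3 (proof of Thm. 6)] -/
theorem bsVal_nil_eq_countWitnesses
    (hnode : ∀ u : List Bool, u.length < m →
      badNode (bsVal D (ansOf A τ u)) (bsVal D (ansOf A τ (u ++ [false])))
        (bsVal D (ansOf A τ (u ++ [true]))) (2 ^ (m - u.length)) = false)
    (hleaf : ∀ u : List Bool, u.length = m → bsVal D (ansOf A τ u) = pcnt R x m u) :
    bsVal D (ansOf A τ []) = countWitnesses R m x := by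
  rw [← pcnt_nil]
  refine eq_pcnt_of_consistent (g := fun u => bsVal D (ansOf A τ u)) hleaf (fun u hu => ?_) [] (by simp)
  have h := hnode u hu
  have h' : ¬ (badNode (bsVal D (ansOf A τ u)) (bsVal D (ansOf A τ (u ++ [false])))
      (bsVal D (ansOf A τ (u ++ [true]))) (2 ^ (m - u.length)) = true) := by rw [h]; exact Bool.false_ne_true
  rw [badNode_eq_true_iff] at h'
  simp only [not_or, not_lt, ne_eq, not_not] at h'
  exact h'.2.2.2

end PPRefuter

end Literature.Computability.MetaComplexity
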